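import Literature.Barriers.QuantumAdvantage.AaronsonChenAdviceWeights
import Literature.Computability.QuantumComplexity.GuessedAnnRuns
import HarnessLib

/-!
# Aaronson–Chen 2017, Lemma 5.3: the tabled run in the guessed-walk vocabulary

Support file for `aaronsonChen2017_lem53` (`AaronsonChenOracle.lean`). Two annotations of a
Clifford+`T` gate list by per-gate oracle languages exist in the tree with the same recursion:
`AcSim.annTab tabs gs` (`AaronsonChenAdviceWeights.lean`: gate `u` carries `TQBF ⊕ tabs u`, the
language of the tabled run `AcSim.tabRun` of the replaced circuit) and `ADH.annotate As gs`
(`QuantumComplexity/GuessedAnnRuns.lean`: gate `t` carries `As t`; its pair counts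
`annSetA`/`annSetB` are sums over pairs of CONSISTENT GUESSED coin strings,
`ADH.annSetA_eq_sum_consG`, the form a polynomial-space machine enumerates — Aaronson–Chen's "all
the computations can be done in `PSPACE`", §5.3 p. 23). This file identifies them, so that the
threshold tests of the advice language (`AcProto.mem_stageList_iff_linFormTest`,
`AcProto.sel_iff_linFormTest`) are statements about `ADH.annotate`:

* **`AcSim.annTab_eq_annotate`**: `annTab tabs gs = annotate (fun u => TQBF ⊕ tabs u) gs`;
  **`AcSim.tabRun_eq_annProd_annotate`**: the tabled run is `annProd (annotate …)` on the vector;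
* `AcProto.stageState_eq_annotate`, `AcProto.finalState_eq_annotate` (the states of the protocol's
  tabled run from `|x₀, 0^m⟩ = basisState (w0 x₀)`), and the threshold forms
  **`AcProto.mem_stageList_iff_linFormTest_annotate`**, **`AcProto.sel_iff_linFormTest_annotate`**
  (heavy tails / the inverse-CDF selection as `linFormTest` on the pair counts of
  `annotate (fun u => TQBF ⊕ tabs u) (gates.take n)` resp. `… gates`).

## References

* [AaronsonChen2017] S. Aaronson, L. Chen, CCC 2017 (doi:10.4230/LIPIcs.CCC.2017.22;
  arXiv:1612.05903), §5.3 (pp. 22–23), read via `lit read arxiv:1612.05903 --pages 21-23`.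
* [AdlemanDeMarraisHuang1997] §6, Lemma 6.10 (pairs of paths), as in `GuessedAnnRuns.lean`.
-/

noncomputable section

namespace Literature.Barriers.QuantumAdvantage

open MeasureTheory _root_.Computability Matrix Polynomial Literature.Computability.Complexity
  Literature.Computability.Cryptography Literature.Computability.QuantumComplexity

namespace AcSim

variable {N : ℕ}

/-- **The two annotations agree**: `annTab tabs` is `ADH.annotate` with the languages
`u ↦ TQBF ⊕ tabs u`. [folklore] -/
theorem annTab_eq_annotate :
    ∀ (tabs : ℕ → Set (List Bool)) (gs : List (QGate cliffordT N)),
      annTab tabs gs = ADH.annotate (fun u => oracleJoin TQBF (tabs u)) gs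
  | _, [] => rfl
  | tabs, g :: gs => by
    rw [annTab_cons, ADH.annotate_cons, annTab_eq_annotate]

/-- **The tabled run is the annotated product in the guessed-walk vocabulary.**
[cite: AaronsonChen2017, §5.3 (p. 23, "C_final")] -/
theorem tabRun_eq_annProd_annotate (tabs : ℕ → Set (List Bool)) (gs : List (QGate cliffordT N)) (v : QReg N → ℂ) :
    tabRun tabs gs v = annProd (ADH.annotate (fun u => oracleJoin TQBF (tabs u)) gs) *ᵥ v := by
  rw [tabRun_eq_annProd_mulVec, annTab_eq_annotate]

end AcSim

namespace AcProto

variable (P : AcProto)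

/-- The state before gate `n` of the protocol's tabled run, as an annotated product on `w0`.
[cite: AaronsonChen2017, §5.3 (p. 23)] -/
theorem stageState_eq_annotate (x₀ : List Bool) (tabs : ℕ → Set (List Bool)) (n : ℕ) :
    AcSim.tabRun tabs ((P.gates x₀).take n) (P.v0 x₀) =
      annProd (ADH.annotate (fun u => oracleJoin TQBF (tabs u)) ((P.gates x₀).take n)) *ᵥ basisState (P.w0 x₀) := by
  rw [P.tabRun_take_eq_annProd, AcSim.annTab_eq_annotate]

/-- The final state of the protocol's tabled run, as an annotated product on `w0`. [folklore] -/
theorem finalState_eq_annotate (x₀ : List Bool) (tabs : ℕ → Set (List Bool)) :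
    AcSim.tabRun tabs (P.gates x₀) (P.v0 x₀) =
      annProd (ADH.annotate (fun u => oracleJoin TQBF (tabs u)) (P.gates x₀)) *ᵥ basisState (P.w0 x₀) := by
  rw [P.tabRun_eq_annProd, AcSim.annTab_eq_annotate]

/-- **The strings queried at stage `n`, by the integer test, in the `annotate` vocabulary.**
[cite: AaronsonChen2017, §5.3 (p. 22, "Construction and Analysis of g"; p. 23)] -/
theorem mem_stageList_iff_linFormTest_annotate (x₀ : List Bool) (tabs : ℕ → Set (List Bool)) (n : ℕ) (u : List Bool) :
    u ∈ P.stageList x₀ tabs n ↔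
      ∃ (k : ℕ) (e : Fin (k + 1 + 1) ↪ Fin (P.nq x₀)), (P.gates x₀)[n]? = some (.oracle (k + 1) e) ∧
        u.length = k ∧ (2 ^ k ≤ P.bud x₀ ∨ (¬ 2 ^ k ≤ P.bud x₀ ∧
          linFormTest (2 ^ hCount ((P.gates x₀).take n)) (-(P.bud x₀ : ℤ)) 0
            (annSetA (ADH.annotate (fun u => oracleJoin TQBF (tabs u)) ((P.gates x₀).take n)) (P.w0 x₀)
              {x | queryOf e x = true :: u})
            (annSetB (ADH.annotate (fun u => oracleJoin TQBF (tabs u)) ((P.gates x₀).take n)) (P.w0 x₀)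
              {x | queryOf e x = true :: u})
            0 0 = false)) := by
  rw [P.mem_stageList_iff_linFormTest, AcSim.annTab_eq_annotate]

/-- **The selection predicate by the integer test, in the `annotate` vocabulary.**
[cite: AaronsonChen2017, §5.3 (p. 23, "takes a sample z by measuring |v_{T+1}⟩")] -/
theorem sel_iff_linFormTest_annotate (x₀ r h : List Bool) (i : ℕ) :
    P.Sel x₀ r h i ↔ i < 2 ^ P.nq x₀ ∧
      linFormTest (-((bitsToNat r : ℤ) * 2 ^ hCount (P.gates x₀))) (2 ^ r.length) 0
        (annSetA (ADH.annotate (fun u => oracleJoin TQBF (P.tabsOf x₀ r h u)) (P.gates x₀)) (P.w0 x₀)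
          {y | bitsToNat (List.ofFn y) ≤ i})
        (annSetB (ADH.annotate (fun u => oracleJoin TQBF (P.tabsOf x₀ r h u)) (P.gates x₀)) (P.w0 x₀)
          {y | bitsToNat (List.ofFn y) ≤ i})
        0 0 = true := by
  rw [P.sel_iff_linFormTest, AcSim.annTab_eq_annotate]

end AcProto

end Literature.Barriers.QuantumAdvantage

end
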